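import Literature.Analysis.UnboundedOperators.WeaklySingularDuhamel
import Literature.Analysis.UnboundedOperators.SemilinearMildFlowOperators
import HarnessLib

/-!
# Time regularity of the weakly singular Duhamel integral for a norm-continuous kernel

Analysis/UnboundedOperators support file (theorems only, everything proved, no named facts, no
definitions).  Let `K : (0, ∞) → L(E, F)` be a family of bounded operators which is weakly singular,
`‖K(t)‖ ≤ C t^{-α}` with `0 ≤ α < 1`, and **continuous in operator norm** on `(0, ∞)` (the model is
`K(t) = A^α e^{-tA}` for a sectorial `A`: D. Henry, *Geometric Theory of Semilinear Parabolic Equations*,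
LNM 840 (1981), Thm 1.4.3; A. Pazy, *Semigroups of Linear Operators and Applications to PDE* (1983),
Thm 2.6.13 — analytic semigroups are norm continuous for `t > 0`).  For a continuous bounded
`g : ℝ → E` put `D g (t) = ∫₀ᵗ K(t − s) g(s) ds`.  We prove that `t ↦ D g (t)` is continuous
**uniformly over the family `{g : sup ‖g‖ ≤ M}`**, with a modulus depending on `K` and `M` only:

* `norm_integral_duhamel_sub_le` — for `0 ≤ a ≤ b`,
  `‖D g (b) − D g (a)‖ ≤ M (∫₀ᵃ ‖K(u + (b − a)) − K(u)‖ du + C (b − a)^{1−α}/(1 − α))`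
  (split `∫₀ᵇ = ∫₀ᵃ + ∫ₐᵇ`; the window is bounded by the kernel mass, the past by the kernel increment
  after the substitution `u = a − s`);
* `tendsto_integral_norm_sub_shift` — `∫₀ᵃ ‖K(u + d) − K(u)‖ du → 0` as `d → 0⁺` (dominated convergence:
  pointwise convergence is the norm continuity of `K`, the dominating function is `2C u^{-α}`, which is
  where `α ≥ 0` is used);
* `exists_forall_norm_integral_duhamel_sub_le` — **the uniform modulus**: for `t₀ ≥ 0` and `ε > 0`
  there is `δ > 0` with `‖D g (t) − D g (t₀)‖ ≤ ε M` whenever `t ≥ 0`, `|t − t₀| < δ`, `g` is continuous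
  and `‖g‖ ≤ M`.

This is the estimate behind the continuity `t ↦ W(t)` **in operator norm** on `(0, τ]` of the solution
operators `W(t) h = w_h(t)` of linear mild (Volterra) equations `w(t) = T(t) h − ∫₀ᵗ K(t − s) B(s) w(s) ds`
(Henry 1981, §7.1, the evolution operators of linear non-autonomous parabolic equations), applied to the
family `g_h = B(·) w_h(·)`, `‖h‖ ≤ 1`, which is uniformly bounded but not otherwise controlled.  The
strongly continuous theory (continuity of `D g` for ONE `g`) is the sibling `WeaklySingularDuhamel.lean`.

## References

* D. Henry, *Geometric Theory of Semilinear Parabolic Equations*, LNM 840, Springer (1981), Thm 1.4.3,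
  Lemma 3.3.2, §7.1. [Henry1981]
* A. Pazy, *Semigroups of Linear Operators and Applications to Partial Differential Equations*,
  Springer (1983), Thm 2.6.13, §6.3. [Pazy1983]
-/

open MeasureTheory Set Filter intervalIntegral
open _root_.Topology

namespace Literature.Analysis.UnboundedOperators

variable {E F : Type*} [NormedAddCommGroup E] [NormedSpace ℝ E] [NormedAddCommGroup F]
  [NormedSpace ℝ F]

/-! ### The kernel increment `u ↦ K(u + d) − K(u)` -/

/-- Pointwise bound on the kernel increment: for `u > 0`, `d ≥ 0` and `0 ≤ α`,
`‖K(u + d) − K(u)‖ ≤ C (u + d)^{-α} + C u^{-α} ≤ 2 C u^{-α}`. [folklore] -/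
theorem norm_sub_shift_le {α C : ℝ} {K : ℝ → E →L[ℝ] F} (hα₀ : 0 ≤ α) (hC : 0 ≤ C)
    (hK : ∀ t, 0 < t → ‖K t‖ ≤ C * t ^ (-α)) {u d : ℝ} (hu : 0 < u) (hd : 0 ≤ d) :
    ‖K (u + d) - K u‖ ≤ 2 * C * u ^ (-α) := by
  have h1 : (u + d) ^ (-α) ≤ u ^ (-α) :=
    Real.rpow_le_rpow_of_nonpos hu (le_add_of_nonneg_right hd) (neg_nonpos.2 hα₀)
  calc ‖K (u + d) - K u‖ ≤ ‖K (u + d)‖ + ‖K u‖ := norm_sub_le _ _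
    _ ≤ C * (u + d) ^ (-α) + C * u ^ (-α) :=
        add_le_add (hK _ (add_pos_of_pos_of_nonneg hu hd)) (hK u hu)
    _ ≤ C * u ^ (-α) + C * u ^ (-α) := add_le_add (mul_le_mul_of_nonneg_left h1 hC) le_rfl
    _ = 2 * C * u ^ (-α) := by ring

/-- The kernel increment `u ↦ ‖K(u + d) − K(u)‖` (`d ≥ 0`) is continuous on `(0, ∞)` when `K` is
norm continuous there. [folklore] -/
theorem continuousOn_norm_sub_shift {K : ℝ → E →L[ℝ] F} (hKn : ContinuousOn K (Ioi 0)) {d : ℝ}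
    (hd : 0 ≤ d) : ContinuousOn (fun u => ‖K (u + d) - K u‖) (Ioi 0) := by
  refine ContinuousOn.norm (ContinuousOn.sub ?_ hKn)
  exact hKn.comp (continuous_add_const d).continuousOn fun u hu =>
    mem_Ioi.2 (add_pos_of_pos_of_nonneg (mem_Ioi.1 hu) hd)

/-- The kernel increment `u ↦ ‖K(u + d) − K(u)‖` (`d ≥ 0`) is integrable on `[0, a]`: it is continuous
on `(0, ∞)` and dominated by the integrable `2 C u^{-α}` (`0 ≤ α < 1`). [folklore] -/
theorem intervalIntegrable_norm_sub_shift {α C : ℝ} {K : ℝ → E →L[ℝ] F} (hα₀ : 0 ≤ α)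
    (hα : α < 1) (hC : 0 ≤ C) (hK : ∀ t, 0 < t → ‖K t‖ ≤ C * t ^ (-α))
    (hKn : ContinuousOn K (Ioi 0)) {d a : ℝ} (hd : 0 ≤ d) (ha : 0 ≤ a) :
    IntervalIntegrable (fun u => ‖K (u + d) - K u‖) volume 0 a := by
  have hb : IntervalIntegrable (fun u : ℝ => 2 * C * u ^ (-α)) volume 0 a :=
    (intervalIntegral.intervalIntegrable_rpow' (by linarith : (-1 : ℝ) < -α)).const_mul (2 * C)
  refine hb.mono_fun' ?_ ?_
  · rw [uIoc_of_le ha]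
    exact ((continuousOn_norm_sub_shift hKn hd).mono Ioc_subset_Ioi_self).aestronglyMeasurable
      measurableSet_Ioc
  · rw [uIoc_of_le ha]
    refine ae_restrict_of_forall_mem measurableSet_Ioc fun u hu => ?_
    show ‖‖K (u + d) - K u‖‖ ≤ 2 * C * u ^ (-α)
    rw [norm_norm]
    exact norm_sub_shift_le hα₀ hC hK hu.1 hd

/-- **The integrated kernel increment tends to zero** (dominated convergence): if `K` is norm
continuous on `(0, ∞)` with `‖K(t)‖ ≤ C t^{-α}`, `0 ≤ α < 1`, then for every `a ≥ 0`,
`∫₀ᵃ ‖K(u + d) − K(u)‖ du → 0` as `d → 0⁺`.  Pointwise convergence for `u > 0` is the continuity of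
`K` at `u`; the dominating function is `2 C u^{-α}`. [folklore] -/
theorem tendsto_integral_norm_sub_shift {α C : ℝ} {K : ℝ → E →L[ℝ] F} (hα₀ : 0 ≤ α) (hα : α < 1)
    (hC : 0 ≤ C) (hK : ∀ t, 0 < t → ‖K t‖ ≤ C * t ^ (-α)) (hKn : ContinuousOn K (Ioi 0)) {a : ℝ}
    (ha : 0 ≤ a) :
    Tendsto (fun d => ∫ u in (0 : ℝ)..a, ‖K (u + d) - K u‖) (𝓝[≥] 0) (𝓝 0) := by
  have h := intervalIntegral.tendsto_integral_filter_of_dominated_convergence (μ := volume)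
    (a := 0) (b := a) (l := 𝓝[≥] (0 : ℝ)) (F := fun d u => ‖K (u + d) - K u‖)
    (f := fun _ => (0 : ℝ)) (fun u => 2 * C * u ^ (-α)) ?_ ?_ ?_ ?_
  · simpa only [intervalIntegral.integral_zero] using h
  · filter_upwards [self_mem_nhdsWithin] with d hd
    rw [uIoc_of_le ha]
    exact ((continuousOn_norm_sub_shift hKn hd).mono Ioc_subset_Ioi_self).aestronglyMeasurable
      measurableSet_Ioc
  · filter_upwards [self_mem_nhdsWithin] with d hd
    refine ae_of_all _ fun u hu => ?_
    rw [uIoc_of_le ha] at hu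
    rw [norm_norm]
    exact norm_sub_shift_le hα₀ hC hK hu.1 hd
  · exact (intervalIntegral.intervalIntegrable_rpow' (by linarith : (-1 : ℝ) < -α)).const_mul (2 * C)
  · refine ae_of_all _ fun u hu => ?_
    rw [uIoc_of_le ha] at hu
    have hKu : ContinuousAt K u := hKn.continuousAt (Ioi_mem_nhds hu.1)
    have h1 : Tendsto (fun d : ℝ => u + d) (𝓝 0) (𝓝 u) :=
      (continuous_const.add continuous_id).tendsto' 0 u (add_zero u)
    have h2 : Tendsto (fun d : ℝ => ‖K (u + d) - K u‖) (𝓝 0) (𝓝 ‖K u - K u‖) :=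
      ((hKu.tendsto.comp h1).sub tendsto_const_nhds).norm
    rw [sub_self, norm_zero] at h2
    exact h2.mono_left nhdsWithin_le_nhds

/-! ### The uniform modulus of continuity of `t ↦ ∫₀ᵗ K(t − s) g(s) ds` -/

/-- **One-sided increment of the Duhamel integral.**  For `0 ≤ a ≤ b`, a continuous `g` with
`‖g‖ ≤ M`, and a norm-continuous weakly singular kernel (`‖K(t)‖ ≤ C t^{-α}`, `0 ≤ α < 1`),
`‖∫₀ᵇ K(b − s) g(s) ds − ∫₀ᵃ K(a − s) g(s) ds‖ ≤ M (∫₀ᵃ ‖K(u + (b − a)) − K(u)‖ du + C (b − a)^{1−α}/(1 − α))`: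
split `∫₀ᵇ = ∫₀ᵃ + ∫ₐᵇ`, bound the window by the kernel mass `∫ₐᵇ C (b − s)^{-α} ds` and the past by the
kernel increment, substituting `u = a − s`. [folklore] -/
theorem norm_integral_duhamel_sub_le {α C : ℝ} {K : ℝ → E →L[ℝ] F} (hα₀ : 0 ≤ α) (hα : α < 1)
    (hC : 0 ≤ C) (hK : ∀ t, 0 < t → ‖K t‖ ≤ C * t ^ (-α)) (hKn : ContinuousOn K (Ioi 0))
    {g : ℝ → E} (hg : Continuous g) {M : ℝ} (hM : ∀ s, ‖g s‖ ≤ M) {a b : ℝ} (ha : 0 ≤ a)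
    (hab : a ≤ b) :
    ‖(∫ s in (0 : ℝ)..b, K (b - s) (g s)) - ∫ s in (0 : ℝ)..a, K (a - s) (g s)‖ ≤
      M * ((∫ u in (0 : ℝ)..a, ‖K (u + (b - a)) - K u‖) + C * (b - a) ^ (1 - α) / (1 - α)) := by
  have hKc : ∀ y : E, ContinuousOn (fun t : ℝ => K t y) (Ioi 0) := fun y =>
    hKn.clm_apply continuousOn_const
  have hb : 0 ≤ b := ha.trans hab
  have hd : 0 ≤ b - a := sub_nonneg.2 hab
  -- integrability of the two Duhamel integrands
  have hIb : IntervalIntegrable (fun s => K (b - s) (g s)) volume 0 b :=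
    intervalIntegrable_duhamelIntegrand hK hKc hα hg hb
  have hI1 : IntervalIntegrable (fun s => K (b - s) (g s)) volume 0 a :=
    hIb.mono_set (by rw [uIcc_of_le ha, uIcc_of_le hb]; exact Icc_subset_Icc_right hab)
  have hI2 : IntervalIntegrable (fun s => K (b - s) (g s)) volume a b :=
    hIb.mono_set (by rw [uIcc_of_le hab, uIcc_of_le hb]; exact Icc_subset_Icc_left ha)
  have hIa : IntervalIntegrable (fun s => K (a - s) (g s)) volume 0 a :=
    intervalIntegrable_duhamelIntegrand hK hKc hα hg ha
  have hsplit : (∫ s in (0 : ℝ)..b, K (b - s) (g s)) - ∫ s in (0 : ℝ)..a, K (a - s) (g s) =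
      (∫ s in (0 : ℝ)..a, (K (b - s) (g s) - K (a - s) (g s))) + ∫ s in a..b, K (b - s) (g s) := by
    rw [← intervalIntegral.integral_add_adjacent_intervals hI1 hI2,
      intervalIntegral.integral_sub hI1 hIa]
    abel
  -- the window `[a, b]`
  have hwin : ‖∫ s in a..b, K (b - s) (g s)‖ ≤ C * (b - a) ^ (1 - α) / (1 - α) * M := by
    calc ‖∫ s in a..b, K (b - s) (g s)‖ ≤ ∫ s in a..b, C * ((b - s) ^ (-α) * M) := by
          refine intervalIntegral.norm_integral_le_of_norm_le hab ?_ ?_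
          · filter_upwards [compl_mem_ae_iff.mpr (Real.volume_singleton (a := b))] with s hsb hs
            have hsb' : s < b := lt_of_le_of_ne hs.2 hsb
            calc ‖K (b - s) (g s)‖ ≤ C * (b - s) ^ (-α) * ‖g s‖ := norm_duhamelIntegrand_le hK g hsb'
              _ ≤ C * (b - s) ^ (-α) * M := mul_le_mul_of_nonneg_left (hM s)
                  (mul_nonneg hC (Real.rpow_nonneg (sub_pos.2 hsb').le _))
              _ = C * ((b - s) ^ (-α) * M) := mul_assoc _ _ _
          · exact (Literature.Analysis.ODE.intervalIntegrable_sub_rpow_neg_mul hα b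
              continuousOn_const).const_mul C
      _ = C * ((b - a) ^ (1 - α) / (1 - α) * M) := by
          rw [intervalIntegral.integral_const_mul, intervalIntegral.integral_mul_const,
            Literature.Analysis.ODE.integral_sub_rpow_neg hα a b]
      _ = C * (b - a) ^ (1 - α) / (1 - α) * M := by ring
  -- the past `[0, a]`
  have hpast : ‖∫ s in (0 : ℝ)..a, (K (b - s) (g s) - K (a - s) (g s))‖ ≤
      (∫ u in (0 : ℝ)..a, ‖K (u + (b - a)) - K u‖) * M := by
    have hint : IntervalIntegrable (fun s => ‖K (a - s + (b - a)) - K (a - s)‖) volume 0 a := by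
      have h := (intervalIntegrable_norm_sub_shift hα₀ hα hC hK hKn hd ha).comp_sub_left a
      simp only [sub_zero, sub_self] at h
      exact h.symm
    calc ‖∫ s in (0 : ℝ)..a, (K (b - s) (g s) - K (a - s) (g s))‖
        ≤ ∫ s in (0 : ℝ)..a, ‖K (a - s + (b - a)) - K (a - s)‖ * M := by
          refine intervalIntegral.norm_integral_le_of_norm_le ha (ae_of_all _ fun s _ => ?_)
            (hint.mul_const M)
          have e : a - s + (b - a) = b - s := by ring
          rw [← sub_apply, e]
          exact (K (b - s) - K (a - s)).le_opNorm_of_le (hM s)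
      _ = (∫ u in (0 : ℝ)..a, ‖K (u + (b - a)) - K u‖) * M := by
          rw [intervalIntegral.integral_mul_const]
          congr 1
          have h := intervalIntegral.integral_comp_sub_left
            (fun u => ‖K (u + (b - a)) - K u‖) a (a := 0) (b := a)
          simp only [sub_self, sub_zero] at h
          exact h
  calc ‖(∫ s in (0 : ℝ)..b, K (b - s) (g s)) - ∫ s in (0 : ℝ)..a, K (a - s) (g s)‖
      = ‖(∫ s in (0 : ℝ)..a, (K (b - s) (g s) - K (a - s) (g s))) + ∫ s in a..b, K (b - s) (g s)‖ := by
        rw [hsplit]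
    _ ≤ ‖∫ s in (0 : ℝ)..a, (K (b - s) (g s) - K (a - s) (g s))‖ + ‖∫ s in a..b, K (b - s) (g s)‖ :=
        norm_add_le _ _
    _ ≤ (∫ u in (0 : ℝ)..a, ‖K (u + (b - a)) - K u‖) * M + C * (b - a) ^ (1 - α) / (1 - α) * M :=
        add_le_add hpast hwin
    _ = M * ((∫ u in (0 : ℝ)..a, ‖K (u + (b - a)) - K u‖) + C * (b - a) ^ (1 - α) / (1 - α)) := by
        ring

/-- **Uniform modulus of continuity in time of the weakly singular Duhamel integral** for a
norm-continuous kernel (`‖K(t)‖ ≤ C t^{-α}`, `0 ≤ α < 1`, `K` continuous on `(0, ∞)` in operator norm):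
for every `t₀ ≥ 0` and `ε > 0` there is `δ > 0` such that
`‖∫₀ᵗ K(t − s) g(s) ds − ∫₀^{t₀} K(t₀ − s) g(s) ds‖ ≤ ε M` for all `t ≥ 0` with `|t − t₀| < δ` and all
continuous `g` with `‖g‖ ≤ M` — the modulus depends on `K` and the bound `M` only, not on `g`
(Henry 1981, §7.1: continuity in `t` of the evolution operators in `L(E)`).  Proof: the one-sided estimate
`norm_integral_duhamel_sub_le` in both orders of `t, t₀`, the kernel-increment limit
`tendsto_integral_norm_sub_shift`, and `C d^{1−α}/(1 − α) → 0`. [folklore] -/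
theorem exists_forall_norm_integral_duhamel_sub_le {α C : ℝ} {K : ℝ → E →L[ℝ] F} (hα₀ : 0 ≤ α)
    (hα : α < 1) (hC : 0 ≤ C) (hK : ∀ t, 0 < t → ‖K t‖ ≤ C * t ^ (-α))
    (hKn : ContinuousOn K (Ioi 0)) {t₀ : ℝ} (ht₀ : 0 ≤ t₀) {ε : ℝ} (hε : 0 < ε) :
    ∃ δ > 0, ∀ t, 0 ≤ t → |t - t₀| < δ → ∀ (g : ℝ → E) (M : ℝ), Continuous g →
      (∀ s, ‖g s‖ ≤ M) →
      ‖(∫ s in (0 : ℝ)..t, K (t - s) (g s)) - ∫ s in (0 : ℝ)..t₀, K (t₀ - s) (g s)‖ ≤ ε * M := by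
  have hα1 : 0 < 1 - α := by linarith
  have hε2 : 0 < ε / 2 := half_pos hε
  obtain ⟨δ₁, hδ₁, h₁⟩ := Metric.tendsto_nhdsWithin_nhds.1
    (tendsto_integral_norm_sub_shift hα₀ hα hC hK hKn ht₀) (ε / 2) hε2
  obtain ⟨δ₂, hδ₂, -, h₂⟩ := exists_pos_le_mul_rpow_le (β := 1 - α) (M := C / (1 - α))
    (ε := ε / 2) (b := 1) hα1 hε2 one_pos
  refine ⟨min δ₁ δ₂, lt_min hδ₁ hδ₂, fun t ht htδ g M hg hM => ?_⟩
  have hM0 : 0 ≤ M := (norm_nonneg _).trans (hM 0)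
  have hd1 : |t - t₀| < δ₁ := htδ.trans_le (min_le_left _ _)
  have hd2 : |t - t₀| < δ₂ := htδ.trans_le (min_le_right _ _)
  -- the two small quantities, as functions of `d = |t - t₀|`
  have hI : ∀ {d : ℝ}, 0 ≤ d → d < δ₁ → ∫ u in (0 : ℝ)..t₀, ‖K (u + d) - K u‖ ≤ ε / 2 := by
    intro d hd hdδ
    have h := h₁ (show d ∈ Ici (0 : ℝ) from hd)
      (by rwa [dist_zero_right, Real.norm_eq_abs, abs_of_nonneg hd])
    rw [dist_zero_right, Real.norm_eq_abs] at h
    exact ((le_abs_self _).trans_lt h).le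
  have hP : ∀ {d : ℝ}, 0 ≤ d → d < δ₂ → C * d ^ (1 - α) / (1 - α) ≤ ε / 2 := by
    intro d hd hdδ
    calc C * d ^ (1 - α) / (1 - α) = C / (1 - α) * d ^ (1 - α) := by ring
      _ ≤ C / (1 - α) * δ₂ ^ (1 - α) :=
          mul_le_mul_of_nonneg_left (Real.rpow_le_rpow hd hdδ.le hα1.le) (div_nonneg hC hα1.le)
      _ ≤ ε / 2 := h₂
  rcases le_total t₀ t with h | h
  · -- `t₀ ≤ t`
    have hd : 0 ≤ t - t₀ := sub_nonneg.2 h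
    have habs : |t - t₀| = t - t₀ := abs_of_nonneg hd
    rw [habs] at hd1 hd2
    calc ‖(∫ s in (0 : ℝ)..t, K (t - s) (g s)) - ∫ s in (0 : ℝ)..t₀, K (t₀ - s) (g s)‖
        ≤ M * ((∫ u in (0 : ℝ)..t₀, ‖K (u + (t - t₀)) - K u‖) +
            C * (t - t₀) ^ (1 - α) / (1 - α)) :=
          norm_integral_duhamel_sub_le hα₀ hα hC hK hKn hg hM ht₀ h
      _ ≤ M * (ε / 2 + ε / 2) :=
          mul_le_mul_of_nonneg_left (add_le_add (hI hd hd1) (hP hd hd2)) hM0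
      _ = ε * M := by ring
  · -- `t ≤ t₀`
    have hd : 0 ≤ t₀ - t := sub_nonneg.2 h
    have habs : |t - t₀| = t₀ - t := by rw [abs_sub_comm]; exact abs_of_nonneg hd
    rw [habs] at hd1 hd2
    have hmono : ∫ u in (0 : ℝ)..t, ‖K (u + (t₀ - t)) - K u‖ ≤
        ∫ u in (0 : ℝ)..t₀, ‖K (u + (t₀ - t)) - K u‖ :=
      intervalIntegral.integral_mono_interval le_rfl ht h
        (ae_of_all _ fun u => norm_nonneg _)
        (intervalIntegrable_norm_sub_shift hα₀ hα hC hK hKn hd ht₀)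
    rw [norm_sub_rev]
    calc ‖(∫ s in (0 : ℝ)..t₀, K (t₀ - s) (g s)) - ∫ s in (0 : ℝ)..t, K (t - s) (g s)‖
        ≤ M * ((∫ u in (0 : ℝ)..t, ‖K (u + (t₀ - t)) - K u‖) +
            C * (t₀ - t) ^ (1 - α) / (1 - α)) :=
          norm_integral_duhamel_sub_le hα₀ hα hC hK hKn hg hM ht h
      _ ≤ M * (ε / 2 + ε / 2) :=
          mul_le_mul_of_nonneg_left (add_le_add (hmono.trans (hI hd hd1)) (hP hd hd2)) hM0
      _ = ε * M := by ring

end Literature.Analysis.UnboundedOperators
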